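import Summits.Ventures.HodgeRepro2.T5CircleFourier
import Summits.Ventures.HodgeRepro2.T5CayleySU11

/-!
# T5PeriodicRepresentation — representations of SO(2) in the angle coordinate `k(θ)`

Support (seat p1, blind lane) for route/T5-N4-p5.md v10 (N4.3 = (R3), rows P2′: «K_W ∩ H_j¹ = SO(2)»,
«the SO(2)-weights are exactly {3, 5, 7, …}, each once») — the results of T5CircleWeights /
T5CircleWeightSpaces / T5CircleFourier transported to the coordinate the owner's text uses: a
representation of SO(2) is given as `R : ℝ → (V →L[ℂ] V)` in the angle `θ` — multiplicative
(`R (s + t) = R s * R t`), `R 0 = 1`, `2π`-periodic and continuous — and `SO(2) = {k(θ)}` is the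
rotation group `T5CayleySU11.rotation θ = !![cos θ, −sin θ; sin θ, cos θ]`.

Main statements:
* `toCircleRep` — the representation of `Circle` with `toCircleRep R (exp(iθ)) = R θ`
  (well defined by periodicity: `Function.Periodic.lift` through `ℝ/2πℤ ≅ Circle`), continuous;
* `angleWeightSpace R n = {v | ∀ θ, R θ v = e^{inθ} v}` — the weight-`n` space; `isInternal`,
  finite support (`angleWeights`), `V = ⨁_n V_n`;
* `trace_eq_sum` — `tr R(θ) = Σ_n (dim V_n) e^{inθ}`; `finrank_eq_intervalIntegral` —
  `dim V_n = (2π)⁻¹ ∫₀^{2π} tr R(θ) e^{−inθ} dθ`; `forall_finrank_le_one_iff` — «each weight at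
  most once» ⟺ `(2π)⁻¹ ∫₀^{2π} |tr R(θ)|² dθ = #weights`;
* `rotation_periodic`, `continuous_rotation`, `rotationRep` — `θ ↦ π (rotation θ)` for a
  continuous monoid homomorphism `π` out of the `2 × 2` matrices satisfies all four hypotheses.

Honest scope: nothing about (N), U(1,1), the infinite-dimensional π₃⁺ or its weights; the
identification of `K_W ∩ H_j¹` with `{rotation θ}` inside U(1,1) stays T5CayleySU11's.
-/

namespace Summit.Ventures.HodgeRepro2.T5PeriodicRepresentation

open Summit.Ventures.HodgeRepro2 T5CircleWeights T5CircleWeightSpaces T5CircleFourier T5HaarCircle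
open MeasureTheory Real Complex

section Lift

variable {V : Type*} [NormedAddCommGroup V] [InnerProductSpace ℂ V]
  (R : ℝ → V →L[ℂ] V) (hmul : ∀ s t, R (s + t) = R s * R t) (hone : R 0 = 1)
  (hper : Function.Periodic R (2 * π))

/-- `homeomorphCircle'.symm (exp(iθ)) = θ mod 2π`. -/
theorem homeomorphCircle'_symm_exp (θ : ℝ) :
    AddCircle.homeomorphCircle'.symm (Circle.exp θ) = (θ : AddCircle (2 * π)) := by
  rw [Homeomorph.symm_apply_eq, AddCircle.homeomorphCircle'_apply_mk]

include hmul hone in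
/-- The representation of `Circle` attached to a periodic multiplicative `R`:
`toCircleRep R (exp(iθ)) = R θ`. -/
noncomputable def toCircleRep : Circle →* V →L[ℂ] V where
  toFun z := hper.lift (AddCircle.homeomorphCircle'.symm z)
  map_one' := by
    have h0 : AddCircle.homeomorphCircle'.symm (1 : Circle) = ((0 : ℝ) : AddCircle (2 * π)) := by
      rw [← Circle.exp_zero, homeomorphCircle'_symm_exp]
    simp only [h0, Function.Periodic.lift_coe, hone]
  map_mul' z w := by
    obtain ⟨s, rfl⟩ := Circle.exp_surjective z
    obtain ⟨t, rfl⟩ := Circle.exp_surjective w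
    simp only [← Circle.exp_add, homeomorphCircle'_symm_exp, Function.Periodic.lift_coe, hmul]

/-- `toCircleRep R (exp(iθ)) = R θ`. -/
theorem toCircleRep_exp (θ : ℝ) : toCircleRep R hmul hone hper (Circle.exp θ) = R θ := by
  change hper.lift (AddCircle.homeomorphCircle'.symm (Circle.exp θ)) = R θ
  rw [homeomorphCircle'_symm_exp, Function.Periodic.lift_coe]

/-- `toCircleRep R` is continuous when `R` is. -/
theorem continuous_toCircleRep (hcont : Continuous R) :
    Continuous (toCircleRep R hmul hone hper) := by
  have hl : Continuous (hper.lift : AddCircle (2 * π) → V →L[ℂ] V) :=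
    continuous_coinduced_dom.mpr hcont
  show Continuous (hper.lift ∘ AddCircle.homeomorphCircle'.symm)
  exact hl.comp (Homeomorph.continuous _)

/-- The weight-`n` space of `R`: the vectors with `R θ v = e^{inθ} v` for all `θ`. -/
noncomputable def angleWeightSpace (n : ℤ) : Submodule ℂ V :=
  T5WeightSpaces.weightSpace (toCircleRep R hmul hone hper) (zpowChar n)

/-- Membership in the weight-`n` space: `R θ v = e^{inθ} v` for every angle `θ`. -/
theorem mem_angleWeightSpace {n : ℤ} {v : V} :
    v ∈ angleWeightSpace R hmul hone hper n ↔
      ∀ θ : ℝ, R θ v = Complex.exp ((n : ℂ) * (θ * I)) • v := by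
  rw [angleWeightSpace, T5WeightSpaces.mem_weightSpace]
  constructor
  · intro h θ
    have := h (Circle.exp θ)
    rwa [toCircleRep_exp, coe_zpowChar_apply, Circle.coe_exp, ← Complex.exp_int_mul] at this
  · intro h z
    obtain ⟨θ, rfl⟩ := Circle.exp_surjective z
    rw [toCircleRep_exp, coe_zpowChar_apply, Circle.coe_exp, ← Complex.exp_int_mul]
    exact h θ

end Lift

section FiniteDimensional

variable {V : Type*} [NormedAddCommGroup V] [InnerProductSpace ℂ V] [FiniteDimensional ℂ V]
  (R : ℝ → V →L[ℂ] V) (hmul : ∀ s t, R (s + t) = R s * R t) (hone : R 0 = 1)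
  (hper : Function.Periodic R (2 * π)) (hcont : Continuous R)

/-- The finite set of weights of `R`. -/
noncomputable def angleWeights : Finset ℤ := weights (toCircleRep R hmul hone hper)

/-- `n ∈ angleWeights ↔ V_n ≠ ⊥`. -/
theorem mem_angleWeights {n : ℤ} :
    n ∈ angleWeights R hmul hone hper ↔ angleWeightSpace R hmul hone hper n ≠ ⊥ :=
  mem_weights _

variable [MeasurableSpace Circle] [BorelSpace Circle]

include hcont in
/-- `V = ⨁_{n ∈ ℤ} V_n` as an internal direct sum. -/
theorem isInternal_angleWeightSpace :
    DirectSum.IsInternal (angleWeightSpace R hmul hone hper) :=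
  isInternal_weightSpace_zpowChar _ (continuous_toCircleRep R hmul hone hper hcont)

include hcont in
/-- THE CHARACTER OF `R` IS A TRIGONOMETRIC POLYNOMIAL WITH THE MULTIPLICITIES AS COEFFICIENTS:
`tr R(θ) = Σ_{n ∈ angleWeights} (dim V_n) e^{inθ}`. -/
theorem trace_eq_sum (θ : ℝ) :
    LinearMap.trace ℂ V (R θ : V →ₗ[ℂ] V) =
      ∑ n ∈ angleWeights R hmul hone hper,
        (Module.finrank ℂ (angleWeightSpace R hmul hone hper n) : ℂ) *
          Complex.exp ((n : ℂ) * (θ * I)) := by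
  have h := character_eq_sum_finrank_zpow (toCircleRep R hmul hone hper)
    (continuous_toCircleRep R hmul hone hper hcont) (Circle.exp θ)
  simp only [T5SchurOrthogonality.character, toCircleRep_exp] at h
  rw [h]
  refine Finset.sum_congr rfl fun n _ => ?_
  rw [Circle.coe_exp, ← Complex.exp_int_mul]
  rfl

include hcont in
/-- `dim V_n = (2π)⁻¹ ∫₀^{2π} tr R(θ) e^{−inθ} dθ`: the multiplicity of the weight `n` is the
`n`-th Fourier coefficient of the character of `R`. -/
theorem finrank_eq_intervalIntegral (n : ℤ) :
    (Module.finrank ℂ (angleWeightSpace R hmul hone hper n) : ℂ) =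
      (2 * π : ℂ)⁻¹ * ∫ θ in (0 : ℝ)..2 * π,
        LinearMap.trace ℂ V (R θ : V →ₗ[ℂ] V) * Complex.exp (-(n : ℂ) * (θ * I)) := by
  have h := finrank_weightSpace_eq_intervalIntegral (toCircleRep R hmul hone hper)
    (continuous_toCircleRep R hmul hone hper hcont) n
  simp only [T5SchurOrthogonality.character, toCircleRep_exp] at h
  exact h

include hcont in
/-- `Σ_n dim V_n = dim V`. -/
theorem sum_finrank_angleWeightSpace :
    ∑ n ∈ angleWeights R hmul hone hper, Module.finrank ℂ (angleWeightSpace R hmul hone hper n) =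
      Module.finrank ℂ V :=
  sum_finrank_weightSpace_zpowChar _ (continuous_toCircleRep R hmul hone hper hcont)

include hcont in
/-- «EACH WEIGHT OCCURS AT MOST ONCE» ⟺ `∫ |tr R(θ)|² dθ/2π = #weights`, in the angle coordinate. -/
theorem forall_finrank_le_one_iff :
    (∀ n : ℤ, Module.finrank ℂ (angleWeightSpace R hmul hone hper n) ≤ 1) ↔
      (2 * π : ℂ)⁻¹ * ∫ θ in (0 : ℝ)..2 * π,
          LinearMap.trace ℂ V (R θ : V →ₗ[ℂ] V) *
            (starRingEnd ℂ) (LinearMap.trace ℂ V (R θ : V →ₗ[ℂ] V)) =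
        ((angleWeights R hmul hone hper).card : ℂ) := by
  have h := T5CircleFourier.forall_finrank_le_one_iff (toCircleRep R hmul hone hper)
    (continuous_toCircleRep R hmul hone hper hcont)
  rw [integral_haarCircle, Complex.real_smul] at h
  simp only [T5SchurOrthogonality.character, toCircleRep_exp] at h
  push_cast at h
  exact h

end FiniteDimensional

section Rotation

/-- The rotation matrices are `2π`-periodic in the angle. -/
theorem rotation_periodic : Function.Periodic T5CayleySU11.rotation (2 * π) := by
  intro θ
  simp [T5CayleySU11.rotation, Real.cos_add_two_pi, Real.sin_add_two_pi]

/-- `θ ↦ rotation θ` is continuous. -/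
theorem continuous_rotation : Continuous T5CayleySU11.rotation := by
  refine continuous_pi fun i => continuous_pi fun j => ?_
  fin_cases i <;> fin_cases j <;> simp [T5CayleySU11.rotation] <;> fun_prop

/-- `rotation 0 = 1`. -/
theorem rotation_zero : T5CayleySU11.rotation 0 = 1 := by
  ext i j
  fin_cases i <;> fin_cases j <;> simp [T5CayleySU11.rotation]

variable {V : Type*} [NormedAddCommGroup V] [InnerProductSpace ℂ V]

/-- A representation of the `2 × 2` matrices restricted to the rotation group `SO(2) = {k(θ)}`,
in the angle coordinate: `rotationRep ρ θ = π (rotation θ)`. -/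
noncomputable def rotationRep (ρ : Matrix (Fin 2) (Fin 2) ℂ →* (V →L[ℂ] V)) (θ : ℝ) : V →L[ℂ] V :=
  ρ (T5CayleySU11.rotation θ)

/-- `rotationRep ρ` is multiplicative in the angle. -/
theorem rotationRep_add (ρ : Matrix (Fin 2) (Fin 2) ℂ →* (V →L[ℂ] V)) (s t : ℝ) :
    rotationRep ρ (s + t) = rotationRep ρ s * rotationRep ρ t := by
  simp only [rotationRep, T5CayleySU11.rotation_add, map_mul]

/-- `rotationRep ρ 0 = 1`. -/
theorem rotationRep_zero (ρ : Matrix (Fin 2) (Fin 2) ℂ →* (V →L[ℂ] V)) : rotationRep ρ 0 = 1 := by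
  simp only [rotationRep, rotation_zero, map_one]

/-- `rotationRep ρ` is `2π`-periodic. -/
theorem rotationRep_periodic (ρ : Matrix (Fin 2) (Fin 2) ℂ →* (V →L[ℂ] V)) :
    Function.Periodic (rotationRep ρ) (2 * π) := fun θ => by
  simp only [rotationRep, rotation_periodic θ]

/-- `rotationRep ρ` is continuous when `ρ` is. -/
theorem continuous_rotationRep (ρ : Matrix (Fin 2) (Fin 2) ℂ →* (V →L[ℂ] V))
    (hρ : Continuous ρ) : Continuous (rotationRep ρ) :=
  hρ.comp continuous_rotation

/-- The Cayley conjugation `h ↦ C h C⁻¹` of T5CayleySU11 as a monoid homomorphism of the `2 × 2`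
matrices. -/
noncomputable def cayleyConjHom : Matrix (Fin 2) (Fin 2) ℂ →* Matrix (Fin 2) (Fin 2) ℂ where
  toFun := T5CayleySU11.cayleyConj
  map_one' := T5CayleySU11.cayleyConj_one
  map_mul' := T5CayleySU11.cayleyConj_mul

/-- `cayleyConjHom h = cayleyConj h`. -/
theorem cayleyConjHom_apply (h : Matrix (Fin 2) (Fin 2) ℂ) :
    cayleyConjHom h = T5CayleySU11.cayleyConj h := rfl

/-- The diagonal torus `{diag(e^{−iθ}, e^{iθ})}` of the Cayley model is the rotation group
transported: a representation `ρ` restricted to it in the angle coordinate is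
`rotationRep (ρ ∘ cayleyConjHom)`. -/
theorem diag_torus_eq_rotationRep (ρ : Matrix (Fin 2) (Fin 2) ℂ →* (V →L[ℂ] V)) (θ : ℝ) :
    ρ !![Complex.exp (-θ * I), 0; 0, Complex.exp (θ * I)] =
      rotationRep (ρ.comp cayleyConjHom) θ := by
  rw [rotationRep, MonoidHom.comp_apply, cayleyConjHom_apply, T5CayleySU11.cayleyConj_rotation]

end Rotation

section Parametrised

/-- A compact group `K` parametrised by the angle (`e : ℝ → K` continuous, multiplicative, with
`e (2π) = 1`): every continuous unimodular character of `K` is `e θ ↦ e^{inθ}` along the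
parametrisation — the coordinate-free form of «the characters of SO(2) are the e^{inθ}». -/
theorem exists_int_of_character_comp {K : Type*} [Group K] [TopologicalSpace K]
    (e : ℝ → K) (he : Continuous e) (hmul : ∀ s t, e (s + t) = e s * e t) (hper : e (2 * π) = 1)
    (χ : K →* ℂˣ) (hχ : Continuous fun k => (χ k : ℂ)) (hnorm : ∀ k, ‖(χ k : ℂ)‖ = 1) :
    ∃ n : ℤ, ∀ θ : ℝ, (χ (e θ) : ℂ) = Complex.exp ((n : ℂ) * θ * I) :=
  T5CircleCharacters.exists_int_of_continuous_unimodular_periodic (fun θ => (χ (e θ) : ℂ))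
    (hχ.comp he) (fun s t => by rw [hmul, map_mul, Units.val_mul]) (fun θ => hnorm _)
    (by rw [hper, map_one, Units.val_one])

end Parametrised

end Summit.Ventures.HodgeRepro2.T5PeriodicRepresentation
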